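import Summits.ValiantsHypothesis.ValiantsHypothesis.Theorems.LacunarySymmetroidMatrixDescartesDoorA26WallBubblingWeylTripleSlots

/-!
# Wall bubbling for `DoorA26` — WEYL QUADRUPLES: THE SLOT COUNT OF THE CLUSTER LIMIT UNDER THE RIGIDITY DICHOTOMY (`≤ 19` zeros with multiplicity)

HONEST FRAMING.  Chain lemma toward `TripleStratum26` of `Cruxes/DoorA26/Lines/wall_bubbling_ConfluentDoor.lean` (rev 13; crux `DoorA26`,
stmt-ValiantsHypothesis-19979 — OPEN, typed, never asserted).  W1 seat val-sym-door-p2 g15 (#96); the [4,1,1] clone of #86 `…WeylTripleSlots`.  BOOKKEEPING ONLY (def-free).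
The function-level limit of a single cluster at the stratum [4,1,1] (values `e : Fin 3 → ℝ`, the quadruple at value `e 2`, 2-Sidon) is
`g(s) = Σ_{k ∈ Fin 3 × Fin 3} Q_k(s)·e^{(e k₁ + e k₂)s}` with ORDERED classes, `Q_k` of degree `< n_k`, `n_{(2,2)} = 10`, `n_{(2,x)} = n_{(x,2)} = 4`,
`n_{(x,y)} = 1` (`x, y < 2`), symmetric coefficients.  Uses #86's `weylTriple_limit_extSum` and class-polynomial lemmas.  This file proves:

* **`weylQuad_zerosWithMultiplicity_le`** — under the RIGIDITY DICHOTOMY «`c_{(2,2),9} = 0` OR every pure coefficient `c_{(x,y),0} = 0`» and one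
  non-zero coefficient, `g` has at most `19` real zeros counted with multiplicity (slots `9+8+3 = 20` resp. `10+8+0 = 18`, both `≤ 20`; W1 #12
  `extSum_zerosWithMultiplicity_le`) — NO door.

Nothing here bears on `DoorA26`, `MatrixDescartes` (stmt-ValiantsHypothesis-18050) or `VP ≠ VNP`; `TripleStratum26`, (W), (M) OPEN.
`--supports stmt-ValiantsHypothesis-19979 --as helper`.  [folklore] Laguerre–Pólya slot count.  [this work] the quadruple's slot table.
-/

-- `Summit.ValiantsHypothesis.ValiantsHypothesis.…` repeats a component by the D-0017 layout
-- (single-conjunct summit), which the `dupNamespace` linter flags; the name is mandated.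
set_option linter.dupNamespace false

namespace Summit.ValiantsHypothesis.ValiantsHypothesis.Theorems.LacunarySymmetroidMatrixDescartes.WallBubbling

open Finset Polynomial
open Literature.Analysis.TotalPositivity.LaguerreRuleOfSigns (ZerosWithMultiplicityLE)
open scoped BigOperators

/-! ## The slot count at the Weyl quadruple -/

/-- **THE SLOT COUNT OF THE WEYL-QUADRUPLE CLUSTER LIMIT.**  Values `e : Fin 3 → ℝ` 2-Sidon, ordered classes `k : Fin 3 × Fin 3` with slot
numbers `10 / 4 / 1`, symmetric coefficients, one non-zero coefficient, and the RIGIDITY DICHOTOMY ⇒ at most `19` zeros with multiplicity. [this work] -/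
theorem weylQuad_zerosWithMultiplicity_le (e : Fin 3 → ℝ)
    (hvg : ∀ a b c d : Fin 3, e a + e b = e c + e d → (a = c ∧ b = d) ∨ (a = d ∧ b = c))
    (c : Fin 3 × Fin 3 → ℕ → ℝ) (hsymm : ∀ k m, c k.swap m = c k m)
    (hne : ∃ k m, m < (fun k : Fin 3 × Fin 3 => if k.1 = 2 ∧ k.2 = 2 then 10 else if k.1 = 2 ∨ k.2 = 2 then 4 else 1) k ∧ c k m ≠ 0)
    (hdich : c (2, 2) 9 = 0 ∨ ∀ k : Fin 3 × Fin 3, k.1 ≠ 2 → k.2 ≠ 2 → c k 0 = 0) :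
    ZerosWithMultiplicityLE
      (fun s => ∑ k : Fin 3 × Fin 3,
        (∑ m ∈ Finset.range ((fun k : Fin 3 × Fin 3 => if k.1 = 2 ∧ k.2 = 2 then 10 else if k.1 = 2 ∨ k.2 = 2 then 4 else 1) k),
          c k m * s ^ m / (m.factorial : ℝ)) * Real.exp ((e k.1 + e k.2) * s))
      Set.univ 19 := by
  classical
  -- slot numbers, class polynomials, values
  set n : Fin 3 × Fin 3 → ℕ := fun k => if k.1 = 2 ∧ k.2 = 2 then 10 else if k.1 = 2 ∨ k.2 = 2 then 4 else 1 with hn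
  set Q : Fin 3 × Fin 3 → ℝ[X] := fun k => ∑ m ∈ Finset.range (n k), C (c k m / (m.factorial : ℝ)) * X ^ m with hQ
  set w : Fin 3 × Fin 3 → ℝ := fun k => e k.1 + e k.2 with hw
  set F : Finset ℝ := (univ : Finset (Fin 3 × Fin 3)).image w with hFdef
  set P : ℝ → ℝ[X] := fun v => ∑ k, if w k = v then Q k else 0 with hP
  have hF : ∀ k, w k ∈ F := fun k => Finset.mem_image.mpr ⟨k, Finset.mem_univ _, rfl⟩
  -- the function is the extended sum over `F`
  have hfun : (fun s => ∑ k : Fin 3 × Fin 3, (∑ m ∈ Finset.range (n k), c k m * s ^ m / (m.factorial : ℝ)) * Real.exp ((e k.1 + e k.2) * s))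
      = fun s => ∑ v ∈ F, (P v).eval s * Real.exp (v * s) := by
    funext s
    rw [← weylTriple_limit_extSum w Q F hF s]
    refine Finset.sum_congr rfl fun k _ => ?_
    rw [hQ, eval_classPoly]
  rw [hfun]
  -- fibres by 2-Sidon-ness: `w k = w k'` iff `k' ∈ {k, k.swap}`
  have hfib : ∀ k k' : Fin 3 × Fin 3, w k' = w k → k' = k ∨ k' = k.swap := by
    intro k k' h
    rcases hvg k'.1 k'.2 k.1 k.2 h with ⟨h1, h2⟩ | ⟨h1, h2⟩
    · left; exact Prod.ext h1 h2
    · right; exact Prod.ext h1 h2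
  have hn_swap : ∀ k : Fin 3 × Fin 3, n k.swap = n k := by
    intro k; simp only [hn, Prod.fst_swap, Prod.snd_swap]
    by_cases h1 : k.1 = 2 <;> by_cases h2 : k.2 = 2 <;> simp [h1, h2]
  -- degree bound of `P v` by the slot number of any class in its fibre
  have hdegP : ∀ k : Fin 3 × Fin 3, ∀ d : ℕ, (Q k).natDegree ≤ d → (Q k.swap).natDegree ≤ d → (P (w k)).natDegree ≤ d := by
    intro k d hk hks
    refine natDegree_sum_le_of_forall_le _ _ fun k' _ => ?_
    by_cases h : w k' = w k
    · rw [if_pos h]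
      rcases hfib k k' h with rfl | rfl
      · exact hk
      · exact hks
    · rw [if_neg h, natDegree_zero]; exact Nat.zero_le _
  have hdegQ : ∀ k, (Q k).natDegree ≤ n k - 1 := fun k => natDegree_classPoly_le (c k) (n k)
  -- some `P v` is non-zero
  have hPne : ∃ v ∈ F, P v ≠ 0 := by
    obtain ⟨k₀, m₀, hm₀, hc₀⟩ := hne
    refine ⟨w k₀, hF k₀, fun h0 => hc₀ ?_⟩
    have hcoeff : (P (w k₀)).coeff m₀ = 0 := by rw [h0, coeff_zero]
    rw [hP] at hcoeff
    simp only at hcoeff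
    rw [finsetSum_coeff] at hcoeff
    -- the fibre of `w k₀` is `{k₀, k₀.swap}`
    have hterm : ∀ k' : Fin 3 × Fin 3, (if w k' = w k₀ then Q k' else 0).coeff m₀
        = if k' = k₀ ∨ k' = k₀.swap then c k₀ m₀ / (m₀.factorial : ℝ) else 0 := by
      intro k'
      by_cases h : w k' = w k₀
      · rw [if_pos h, if_pos (hfib k₀ k' h)]
        rcases hfib k₀ k' h with rfl | rfl
        · exact coeff_classPoly _ _ _ hm₀
        · rw [hQ]; simp only
          rw [hn_swap, coeff_classPoly _ _ _ hm₀, hsymm]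
      · have h' : ¬ (k' = k₀ ∨ k' = k₀.swap) := by
          rintro (rfl | rfl)
          · exact h rfl
          · exact h (by simp only [hw, Prod.fst_swap, Prod.snd_swap]; ring)
        rw [if_neg h, if_neg h', coeff_zero]
    simp only [hterm] at hcoeff
    rw [Finset.sum_ite, Finset.sum_const_zero, add_zero, Finset.sum_const, nsmul_eq_mul] at hcoeff
    have hcard : 0 < (Finset.univ.filter fun k' : Fin 3 × Fin 3 => k' = k₀ ∨ k' = k₀.swap).card :=
      Finset.card_pos.mpr ⟨k₀, Finset.mem_filter.mpr ⟨Finset.mem_univ _, Or.inl rfl⟩⟩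
    have hm0 : (m₀.factorial : ℝ) ≠ 0 := by positivity
    rcases mul_eq_zero.mp hcoeff with h | h
    · exact absurd h (ne_of_gt (by exact_mod_cast hcard))
    · rcases div_eq_zero_iff.mp h with h | h
      · exact h
      · exact absurd h hm0
  -- the slot count: split `F` into the triple value, the mixed values and the pure values
  set F33 : Finset ℝ := {w (2, 2)} with hF33
  set Fmix : Finset ℝ := (univ : Finset (Fin 2)).image (fun x => w (x.castSucc, 2)) with hFmix
  set Fpure : Finset ℝ := (univ : Finset (Fin 2 × Fin 2)).image (fun xy => w (xy.1.castSucc, xy.2.castSucc)) with hFpure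
  have hcover : F ⊆ F33 ∪ Fmix ∪ Fpure := by
    intro v hv
    obtain ⟨k, -, rfl⟩ := Finset.mem_image.mp hv
    obtain ⟨k1, k2⟩ := k
    by_cases h1 : k1 = 2 <;> by_cases h2 : k2 = 2
    · subst h1; subst h2; exact Finset.mem_union_left _ (Finset.mem_union_left _ (Finset.mem_singleton_self _))
    · subst h1
      obtain ⟨x, hx⟩ : ∃ x : Fin 2, x.castSucc = k2 := ⟨⟨k2.val, by omega⟩, Fin.ext rfl⟩
      refine Finset.mem_union_left _ (Finset.mem_union_right _ (Finset.mem_image.mpr ⟨x, Finset.mem_univ _, ?_⟩))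
      rw [← hx]; simp only [hw]; ring
    · subst h2
      obtain ⟨x, hx⟩ : ∃ x : Fin 2, x.castSucc = k1 := ⟨⟨k1.val, by omega⟩, Fin.ext rfl⟩
      exact Finset.mem_union_left _ (Finset.mem_union_right _ (Finset.mem_image.mpr ⟨x, Finset.mem_univ _, by rw [← hx]⟩))
    · obtain ⟨x, hx⟩ : ∃ x : Fin 2, x.castSucc = k1 := ⟨⟨k1.val, by omega⟩, Fin.ext rfl⟩
      obtain ⟨y, hy⟩ : ∃ y : Fin 2, y.castSucc = k2 := ⟨⟨k2.val, by omega⟩, Fin.ext rfl⟩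
      exact Finset.mem_union_right _ (Finset.mem_image.mpr ⟨(x, y), Finset.mem_univ _, by rw [← hx, ← hy]⟩)
  -- slot function and its bounds on the three pieces
  set slot : ℝ → ℕ := fun v => if P v = 0 then 0 else (P v).natDegree + 1 with hslot
  have hc3 : ∀ x : Fin 2, (x.castSucc : Fin 3) ≠ 2 := by
    intro x h; have := congrArg Fin.val h; simp at this; omega
  have hslot33 : slot (w (2, 2)) ≤ (if c (2, 2) 9 = 0 then 9 else 10) := by
    simp only [hslot]
    split_ifs with hP0 h5 h5
    · exact Nat.zero_le _
    · exact Nat.zero_le _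
    · have hq : (Q (2, 2)).natDegree ≤ 8 := by
        have := natDegree_classPoly_le_of_top_eq_zero (c (2, 2)) 10 (by norm_num) (by simpa using h5)
        simpa [hQ, hn] using this
      have := hdegP (2, 2) 8 hq (by simpa using hq)
      omega
    · have hq : (Q (2, 2)).natDegree ≤ 9 := by simpa [hn] using hdegQ (2, 2)
      have := hdegP (2, 2) 9 hq (by simpa using hq)
      omega
  have hslotmix : ∀ x : Fin 2, slot (w (x.castSucc, 2)) ≤ 4 := by
    intro x
    simp only [hslot]
    split_ifs with hP0
    · exact Nat.zero_le _
    · have hq : (Q (x.castSucc, 2)).natDegree ≤ 3 := by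
        have := hdegQ (x.castSucc, 2); simp only [hn, hc3 x, false_and, if_false, or_true, if_true] at this; simpa using this
      have hqs : (Q (Prod.swap (x.castSucc, (2 : Fin 3)))).natDegree ≤ 3 := by
        have := hdegQ ((2 : Fin 3), x.castSucc); simp only [hn, hc3 x, and_false, if_false, true_or, if_true] at this
        simpa using this
      have := hdegP (x.castSucc, 2) 3 hq hqs
      omega
  have hslotpure : ∀ xy : Fin 2 × Fin 2, slot (w (xy.1.castSucc, xy.2.castSucc)) ≤ (if c (2, 2) 9 = 0 then 1 else 0) := by
    intro xy
    simp only [hslot]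
    rcases hdich with h5 | hpure
    · rw [if_pos h5]
      split_ifs with hP0
      · exact Nat.zero_le _
      · have hq : ∀ k : Fin 3 × Fin 3, k.1 ≠ 2 → k.2 ≠ 2 → (Q k).natDegree ≤ 0 := by
          intro k h1 h2; have := hdegQ k; simp only [hn, h1, h2, false_and, if_false, or_self] at this; simpa using this
        have := hdegP (xy.1.castSucc, xy.2.castSucc) 0 (hq _ (hc3 _) (hc3 _)) (hq _ (hc3 _) (hc3 _))
        omega
    · -- every class in the fibre is pure with vanishing coefficient: `P = 0`
      have hP0 : P (w (xy.1.castSucc, xy.2.castSucc)) = 0 := by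
        rw [hP]; simp only
        refine Finset.sum_eq_zero fun k' _ => ?_
        by_cases h : w k' = w (xy.1.castSucc, xy.2.castSucc)
        · rw [if_pos h]
          have hQ0 : ∀ k : Fin 3 × Fin 3, k.1 ≠ 2 → k.2 ≠ 2 → Q k = 0 := by
            intro k h1 h2
            rw [hQ]; simp only
            have hnk : n k = 1 := by simp only [hn, h1, h2, false_and, if_false, or_self]
            rw [hnk, Finset.sum_range_one, hpure k h1 h2, zero_div, map_zero, zero_mul]
          rcases hfib _ k' h with rfl | rfl
          · exact hQ0 _ (hc3 _) (hc3 _)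
          · exact hQ0 _ (hc3 _) (hc3 _)
        · rw [if_neg h]
      rw [if_pos hP0]
      exact Nat.zero_le _
  -- sum over `F`
  have hslot_nonneg : ∀ v, 0 ≤ slot v := fun v => Nat.zero_le _
  have hul : ∀ s t : Finset ℝ, ∑ v ∈ s ∪ t, slot v ≤ ∑ v ∈ s, slot v + ∑ v ∈ t, slot v := by
    intro s t; rw [← Finset.sum_union_inter]; exact Nat.le_add_right _ _
  have hsumF : ∑ v ∈ F, slot v ≤ ∑ v ∈ F33, slot v + ∑ v ∈ Fmix, slot v + ∑ v ∈ Fpure, slot v := by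
    calc ∑ v ∈ F, slot v ≤ ∑ v ∈ F33 ∪ Fmix ∪ Fpure, slot v := Finset.sum_le_sum_of_subset_of_nonneg hcover fun v _ _ => hslot_nonneg v
      _ ≤ ∑ v ∈ F33 ∪ Fmix, slot v + ∑ v ∈ Fpure, slot v := hul _ _
      _ ≤ ∑ v ∈ F33, slot v + ∑ v ∈ Fmix, slot v + ∑ v ∈ Fpure, slot v := Nat.add_le_add_right (hul _ _) _
  have h33 : ∑ v ∈ F33, slot v ≤ (if c (2, 2) 9 = 0 then 9 else 10) := by rw [hF33, Finset.sum_singleton]; exact hslot33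
  have hmix : ∑ v ∈ Fmix, slot v ≤ 8 := by
    calc ∑ v ∈ Fmix, slot v ≤ ∑ _x : Fin 2, 4 := by
          rw [hFmix]
          refine (Finset.sum_image_le_of_nonneg (fun v _ => hslot_nonneg v)).trans ?_   -- Σ over image ≤ Σ over domain
          exact Finset.sum_le_sum fun x _ => hslotmix x
      _ = 8 := by simp
  have hpure : ∑ v ∈ Fpure, slot v ≤ 3 * (if c (2, 2) 9 = 0 then 1 else 0) := by
    -- `Fpure` has at most `3` elements, each slot bounded
    have hcard : Fpure.card ≤ 3 := by
      have hsub : Fpure ⊆ {w ((0 : Fin 2).castSucc, (0 : Fin 2).castSucc), w ((0 : Fin 2).castSucc, (1 : Fin 2).castSucc),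
          w ((1 : Fin 2).castSucc, (1 : Fin 2).castSucc)} := by
        intro v hv
        rw [hFpure] at hv
        obtain ⟨⟨x, y⟩, -, rfl⟩ := Finset.mem_image.mp hv
        have h2 : ∀ z : Fin 2, z = 0 ∨ z = 1 := by decide
        simp only [Finset.mem_insert, Finset.mem_singleton]
        rcases h2 x with rfl | rfl <;> rcases h2 y with rfl | rfl
        · exact Or.inl rfl
        · exact Or.inr (Or.inl rfl)
        · exact Or.inr (Or.inl (by simp only [hw]; ring))
        · exact Or.inr (Or.inr rfl)
      exact (Finset.card_le_card hsub).trans Finset.card_le_three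
    have hbd : ∀ v ∈ Fpure, slot v ≤ (if c (2, 2) 9 = 0 then 1 else 0) := by
      intro v hv
      obtain ⟨xy, -, rfl⟩ := Finset.mem_image.mp hv
      exact hslotpure xy
    calc ∑ v ∈ Fpure, slot v ≤ ∑ _v ∈ Fpure, (if c (2, 2) 9 = 0 then 1 else 0) := Finset.sum_le_sum hbd
      _ = Fpure.card * (if c (2, 2) 9 = 0 then 1 else 0) := by rw [Finset.sum_const, smul_eq_mul]
      _ ≤ 3 * (if c (2, 2) 9 = 0 then 1 else 0) := Nat.mul_le_mul_right _ hcard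
  have hslots : ∑ v ∈ F, slot v ≤ 19 + 1 := by
    have h := hsumF
    split_ifs at h33 hpure with h5 <;> omega
  exact Bubbling.extSum_zerosWithMultiplicity_le 19 F P hPne (by simpa [hslot] using hslots)

end Summit.ValiantsHypothesis.ValiantsHypothesis.Theorems.LacunarySymmetroidMatrixDescartes.WallBubbling
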